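import Literature.Probability.FitznerVanDerHofstad2017.SrwIntegralBesselU
import Literature.Probability.FitznerVanDerHofstad2017.SrwIntegralUZero
import Mathlib.MeasureTheory.Integral.Prod
import HarnessLib

/-!
# Schwinger parametrisation of `Ĉⁿ` under the cube integral

For simple random walk on `ℤ^d` (`D̂(k) = d⁻¹ Σ_j cos k_j`, `Ĉ(k) = Ĉ₁(k) = [1 - D̂(k)]⁻¹`,
cube `[-π,π]^d` with Lebesgue measure `P d`):

* `measure_setOf_Dhat_eq_one : P d {k | D̂(k) = 1} = 0` (the singular set of `Ĉ` is null);
* `integral_mul_Chat_pow_succ_eq_integral_Ioi`: for every a.e.-strongly-measurable weight `W`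
  with `W · Ĉ^{n+1}` integrable,
  `∫ W(k) Ĉ(k)^{n+1} dk = (n!)⁻¹ ∫₀^∞ τⁿ (∫ W(k) e^{-(1 - D̂(k)) τ} dk) dτ`
  — the Schwinger / Gamma-function parametrisation `a^{-(n+1)} = (n!)⁻¹ ∫₀^∞ τⁿ e^{-aτ} dτ`
  (`integral_pow_mul_exp_neg_mul_Ioi`) applied at `a = 1 - D̂(k) > 0` for a.e. `k` and
  justified by Fubini–Tonelli on `P d ⊗ Lebesgue|_{(0,∞)}` (the fibre norm integrals are
  `|W| Ĉ^{n+1}`, integrable by hypothesis);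
* instances for the NoBLE SRW integrals ((3.35)–(3.36)): `srwI_succ_eq_integral_Ioi`,
  `srwK_succ_eq_integral_Ioi` (`d ≥ 2n + 3`).

This is the cube-side companion of the series-side `u`-representation
`srwI_succ_zero_eq_integral_prod_srwHeatKernel` (`SrwIntegralBesselU`): it holds for arbitrary,
in particular non-smooth (`|D̂|^l |D̂^{(x)}|`), weights, for which no walk-counting series is
available; after it the `k`-integrand `W(k) e^{τ D̂(k)}` is smooth in `k` apart from `W`.
Everything is `d`-generic; no numerical value is asserted.

## Part II (section `AxisTransform`) — axis atoms factorise into one-coordinate transforms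

For the axis sites `x = m e_i` (`m : ℤ`) the symmetrised phase is `d · D̂^{(m e_i)}(k) = Σ_j cos(m k_j)`
(`natCast_mul_DhatSym_single_intCast`), so under the Schwinger parametrisation every factor of the
integrand is a product over coordinates and the cube integral FACTORISES (Fubini on `P d = μI^{⊗d}`,
`MeasureTheory.integral_fintype_prod_eq_prod`):

* `integral_exp_mul_Dhat_P (τ) : ∫ e^{τ D̂(k)} dk = (∫_{-π}^{π} e^{(τ/d) cos t} dt)^d`
  (`= (2π I₀(τ/d))^d`, [DLMF 10.32.1]; we keep the integral);
* the one-coordinate transform `B_m(a, β) := ∫_{-π}^{π} e^{a cos t + i β cos(m t)} dt` (written out as an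
  integral over `μI` in every statement — no new definition; `B_m(a,0) = 2π I₀(a)`, `B_1(0,β) = 2π J₀(β)`,
  an entire function of `(a, β)`, [DLMF 10.9.1–10.9.2, 10.32.1]);
* `integral_cexp_mul_Dhat_add_P (τ β m) : ∫ e^{τ D̂(k) + iβ Σ_j cos(m k_j)} dk = B_m(τ/d, β)^d`,
  `integral_exp_mul_Dhat_mul_cos_P : ∫ e^{τ D̂(k)} cos(β Σ_j cos(m k_j)) dk = Re B_m(τ/d, β)^d`;
* `integral_one_sub_cos_mul_exp_schwinger_single (τ β i m) :
   ∫ (1 - cos(β d D̂^{(m e_i)}(k))) e^{-(1 - D̂(k))τ} dk = e^{-τ} [(∫ e^{(τ/d) cos t} dt)^d − Re B_m(τ/d, β)^d]`;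
* `integral_one_sub_cos_mul_Chat_pow_succ_single_eq (n) (hd : 2(n+1)+1 ≤ d) (β i m)` — combined with
  Part I: `∫ (1 - cos(β d D̂^{(m e_i)})) Ĉ^{n+1} dk = (n!)⁻¹ ∫₀^∞ τⁿ e^{-τ} [(∫ e^{(τ/d)cos t}dt)^d − Re B_m(τ/d,β)^d] dτ`.

This is exactly the inner integrand of `srwK_eq_integral_cosDefect_scaled` (module `SrwAbsCosineDefect`,
`l = 0`), so that for `d ≥ 2n+3`
`K_{n+1,0}(m e_i) = (2/(πd)) ∫₀^∞ β⁻² (n!)⁻¹ ∫₀^∞ τⁿ e^{-τ} [(∫ e^{(τ/d)cos t}dt)^d − Re B_m(τ/d,β)^d] dτ dβ /(2π)^d`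
— the composition (`srwK_succ_zero_single_eq_integral_axisTransform`, five lines, typechecked in the
filing seat's scratch) imports both modules and is left to a later file. This is steps (2)–(3) of the
characteristic-function quadrature programme for the `K_{n,0}` axis atoms: every SRW integral entering the
NoBLE bounds at these sites is a double integral over `(β, τ) ∈ (0,∞)²` of `d`-th powers of ONE-dimensional
integrals of entire functions. No number at any `d` is asserted here.

-/

noncomputable section

open MeasureTheory Set Filter Real
open scoped Topology Nat

namespace Literature.Probability.FitznerVanDerHofstad2017

open Literature.Barriers.CriticalPhenomena
open Literature.Barriers.CriticalPhenomena.Slade2006Prop53 (μI P)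

section Schwinger

variable {d : ℕ}

/-- The singular set `{D̂ = 1}` of `Ĉ` is `P d`-null — the measure-theoretic form of
"`1 - D̂(k) ≥ 2|k|²/(π²d) > 0` on `[-π,π]^d ∖ {0}`" ((5.1.11), the tree's `one_sub_Dhat_pos`):
on `{D̂ = 1}` every `cos k_j = 1`, so the set lies in the cylinder `{cos k_0 = 1} = {k_0 ∈ 2πℤ}`,
a countable (hence Lebesgue-null) condition on one coordinate.
[cite: HeydenreichVanDerHofstad2017, (5.1.11)] -/
theorem measure_setOf_Dhat_eq_one : P d {k | Dhat d k = 1} = 0 := by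
  rcases Nat.eq_zero_or_pos d with hd | hd
  · subst hd
    have : {k : Fin 0 → ℝ | Dhat 0 k = 1} = ∅ := by
      ext k; simp [Dhat]
    rw [this, measure_empty]
  · set i0 : Fin d := ⟨0, hd⟩ with hi0
    have hdR : (d : ℝ) ≠ 0 := by exact_mod_cast hd.ne'
    set C : Set ℝ := {t : ℝ | Real.cos t = 1} with hC
    have hsub : {k : Fin d → ℝ | Dhat d k = 1}
        ⊆ Set.pi univ (fun j => if j = i0 then C else univ) := by
      intro k hk
      simp only [mem_setOf_eq, Dhat_def, div_eq_one_iff_eq hdR] at hk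
      have h0 : ∑ j, (1 - Real.cos (k j)) = 0 := by
        rw [Finset.sum_sub_distrib, Finset.sum_const, Finset.card_univ, Fintype.card_fin, hk]
        simp
      have hall := (Finset.sum_eq_zero_iff_of_nonneg
        (fun j _ => sub_nonneg.2 (Real.cos_le_one (k j)))).1 h0
      rw [Set.mem_univ_pi]
      intro j
      by_cases hj : j = i0
      · rw [hj]
        simp only [if_true, hC, mem_setOf_eq]
        linarith [hall i0 (Finset.mem_univ i0)]
      · simp [hj]
    refine measure_mono_null hsub ?_
    rw [show P d = Measure.pi (fun _ : Fin d => μI) from rfl, Measure.pi_pi]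
    apply Finset.prod_eq_zero (Finset.mem_univ i0)
    simp only [if_true]
    have hc : C.Countable := by
      have : C = Set.range (fun n : ℤ => (n : ℝ) * (2 * π)) := by
        ext t
        simp only [hC, mem_setOf_eq, Real.cos_eq_one_iff, mem_range]
      rw [this]
      exact Set.countable_range _
    rw [show μI = volume.restrict (Icc (-π) π) from rfl]
    exact hc.measure_zero _

/-- Hence `D̂(k) < 1`, i.e. `Ĉ(k) = [1 - D̂(k)]⁻¹` is a genuine inverse, for `P d`-a.e. `k`
((5.1.11) off the null set `{D̂ = 1}`). [cite: HeydenreichVanDerHofstad2017, (5.1.11)] -/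
theorem ae_Dhat_lt_one : ∀ᵐ k ∂P d, Dhat d k < 1 := by
  rw [ae_iff]
  have : {k : Fin d → ℝ | ¬ Dhat d k < 1} = {k | Dhat d k = 1} := by
    ext k
    simp only [mem_setOf_eq, not_lt]
    exact ⟨fun h => le_antisymm (Dhat_le_one k) h, fun h => h.ge⟩
  rw [this]
  exact measure_setOf_Dhat_eq_one

/-- The Schwinger integrand is jointly continuous, hence strongly measurable. [folklore] -/
private lemma continuous_schwingerKernel (n : ℕ) :
    Continuous fun p : (Fin d → ℝ) × ℝ => p.2 ^ n * Real.exp (-((1 - Dhat d p.1) * p.2)) := by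
  have h1 : Continuous fun p : (Fin d → ℝ) × ℝ => Dhat d p.1 := (continuous_Dhat d).comp continuous_fst
  fun_prop

/-- **Schwinger parametrisation of `Ĉ^{n+1}` under the cube integral.** For an a.e.-strongly
measurable weight `W` on the cube with `W Ĉ^{n+1}` integrable,
`∫ W Ĉ^{n+1} dk = (n!)⁻¹ ∫₀^∞ τⁿ (∫ W(k) e^{-(1-D̂(k))τ} dk) dτ`.
Proof: for `D̂(k) < 1` (a.e., `ae_Dhat_lt_one`) the fibre integral is
`∫₀^∞ τⁿ e^{-(1-D̂)τ} dτ = n! Ĉ^{n+1}` (`integral_pow_mul_exp_neg_mul_Ioi`); the fibre norm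
integrals are `|W| Ĉ^{n+1} n!`, integrable, so Fubini–Tonelli (`integrable_prod_iff`,
`integral_integral_swap`) applies. [cite: FitznerVanDerHofstad2016NoBLE, §5.1.1 (5.2)–(5.4)] -/
theorem integral_mul_Chat_pow_succ_eq_integral_Ioi (n : ℕ) {W : (Fin d → ℝ) → ℝ}
    (hWm : AEStronglyMeasurable W (P d))
    (hW : Integrable (fun k => W k * Chat d 1 k ^ (n + 1)) (P d)) :
    ∫ k, W k * Chat d 1 k ^ (n + 1) ∂P d
      = (n ! : ℝ)⁻¹ * ∫ τ in Ioi (0:ℝ), τ ^ n * ∫ k, W k * Real.exp (-((1 - Dhat d k) * τ)) ∂P d := by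
  set ν : Measure ℝ := volume.restrict (Ioi (0:ℝ)) with hν
  set G : (Fin d → ℝ) → ℝ → ℝ :=
    fun k τ => W k * (τ ^ n * Real.exp (-((1 - Dhat d k) * τ))) with hG
  -- fibre identity off the null set `{D̂ = 1}`
  have hfib : ∀ k, Dhat d k < 1 → ∫ τ, G k τ ∂ν = (n ! : ℝ) * (W k * Chat d 1 k ^ (n + 1)) := by
    intro k hk
    have hr : 0 < 1 - Dhat d k := by linarith
    simp only [hG]
    rw [integral_const_mul, hν, integral_pow_mul_exp_neg_mul_Ioi n hr, Chat_def, one_mul,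
      one_div, inv_pow, div_eq_mul_inv]
    ring
  have hfibN : ∀ k, Dhat d k < 1 →
      ∫ τ, ‖G k τ‖ ∂ν = (n ! : ℝ) * ‖W k * Chat d 1 k ^ (n + 1)‖ := by
    intro k hk
    have hr : 0 < 1 - Dhat d k := by linarith
    have hC : 0 ≤ Chat d 1 k := Chat_one_nonneg k
    have e : ∀ τ, τ ∈ Ioi (0:ℝ) → ‖G k τ‖ = |W k| * (τ ^ n * Real.exp (-((1 - Dhat d k) * τ))) := by
      intro τ hτ
      simp only [hG, norm_mul, Real.norm_eq_abs, Real.abs_exp, abs_pow, abs_of_pos (mem_Ioi.1 hτ)]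
    rw [hν, setIntegral_congr_fun measurableSet_Ioi e, integral_const_mul,
      integral_pow_mul_exp_neg_mul_Ioi n hr, norm_mul, Real.norm_eq_abs, Real.norm_eq_abs,
      abs_of_nonneg (pow_nonneg hC _), Chat_def, one_mul, one_div, inv_pow, div_eq_mul_inv]
    ring
  -- joint measurability
  have hGm : AEStronglyMeasurable (Function.uncurry G) ((P d).prod ν) := by
    have h1 : AEStronglyMeasurable (fun p : (Fin d → ℝ) × ℝ => W p.1) ((P d).prod ν) :=
      hWm.comp_fst
    exact h1.mul (continuous_schwingerKernel n).aestronglyMeasurable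
  -- integrability on the product via the fibre criterion
  have hint : Integrable (Function.uncurry G) ((P d).prod ν) := by
    rw [integrable_prod_iff hGm]
    refine ⟨ae_Dhat_lt_one.mono fun k hk => ?_, ?_⟩
    · have hr : 0 < 1 - Dhat d k := by linarith
      simp only [Function.uncurry, hG]
      rw [hν]
      exact ((integrableOn_pow_mul_exp_neg_mul_Ioi n hr).integrable).const_mul _
    · have heq : (fun k => ∫ τ, ‖Function.uncurry G (k, τ)‖ ∂ν)
          =ᵐ[P d] fun k => (n ! : ℝ) * ‖W k * Chat d 1 k ^ (n + 1)‖ :=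
        ae_Dhat_lt_one.mono fun k hk => by
          simp only [Function.uncurry]
          exact hfibN k hk
      exact (Integrable.congr (hW.norm.const_mul _) heq.symm)
  -- assemble
  have hnf : (n ! : ℝ) ≠ 0 := by positivity
  calc ∫ k, W k * Chat d 1 k ^ (n + 1) ∂P d
      = (n ! : ℝ)⁻¹ * ∫ k, (n ! : ℝ) * (W k * Chat d 1 k ^ (n + 1)) ∂P d := by
        rw [integral_const_mul]; field_simp
    _ = (n ! : ℝ)⁻¹ * ∫ k, ∫ τ, G k τ ∂ν ∂P d := by
        congr 1
        refine integral_congr_ae (ae_Dhat_lt_one.mono fun k hk => ?_)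
        simp only
        exact (hfib k hk).symm
    _ = (n ! : ℝ)⁻¹ * ∫ τ, ∫ k, G k τ ∂P d ∂ν := by rw [integral_integral_swap hint]
    _ = (n ! : ℝ)⁻¹ * ∫ τ in Ioi (0:ℝ), τ ^ n * ∫ k, W k * Real.exp (-((1 - Dhat d k) * τ)) ∂P d := by
        rw [hν]
        congr 1
        refine integral_congr_ae (ae_of_all _ fun τ => ?_)
        simp only [hG]
        rw [← integral_const_mul]
        congr 1
        funext k
        ring

/-- `W` measurable with `|W| ≤ 1` and `d ≥ 2n + 3` suffice (the standing integrability regime of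
the NoBLE SRW integrals, `integrable_weight_mul_Chat_pow`).
[cite: FitznerVanDerHofstad2016NoBLE, §5.1.1 (5.2)–(5.4)] -/
theorem integral_mul_Chat_pow_succ_eq_integral_Ioi_of_bdd (n : ℕ) (hd : 2 * (n + 1) + 1 ≤ d)
    {W : (Fin d → ℝ) → ℝ} (hWm : Measurable W) (hW1 : ∀ k, |W k| ≤ 1) :
    ∫ k, W k * Chat d 1 k ^ (n + 1) ∂P d
      = (n ! : ℝ)⁻¹ * ∫ τ in Ioi (0:ℝ), τ ^ n * ∫ k, W k * Real.exp (-((1 - Dhat d k) * τ)) ∂P d :=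
  integral_mul_Chat_pow_succ_eq_integral_Ioi n hWm.aestronglyMeasurable
    (integrable_weight_mul_Chat_pow hd hWm hW1)

/-- **`I_{n+1,l}(x)` in Schwinger form**:
`I_{n+1,l}(x) = (n!)⁻¹ ∫₀^∞ τⁿ (∫ D̂^l D̂^{(x)} e^{-(1-D̂)τ} dk/(2π)^d) dτ` for `d ≥ 2n + 3`.
[cite: FitznerVanDerHofstad2016NoBLE, (3.35) p. 1071; §5.1.1 (5.2)–(5.4)] -/
theorem srwI_succ_eq_integral_Ioi (n : ℕ) (hd : 2 * (n + 1) + 1 ≤ d) (l : ℕ) (x : Fin d → ℤ) :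
    srwI d (n + 1) l x
      = (n ! : ℝ)⁻¹ * ∫ τ in Ioi (0:ℝ), τ ^ n *
          ((∫ k, (Dhat d k ^ l * DhatSym d x k) * Real.exp (-((1 - Dhat d k) * τ)) ∂P d)
            / (2 * π) ^ d) := by
  have hWm : Measurable fun k => Dhat d k ^ l * DhatSym d x k :=
    ((continuous_Dhat d).measurable.pow_const l).mul (measurable_DhatSym d x)
  have hW1 : ∀ k, |Dhat d k ^ l * DhatSym d x k| ≤ 1 := fun k => by
    rw [abs_mul, abs_pow]
    exact mul_le_one₀ (abs_Dhat_pow_le_one l k) (abs_nonneg _) (abs_DhatSym_le_one x k)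
  unfold srwI
  rw [integral_mul_Chat_pow_succ_eq_integral_Ioi_of_bdd n hd hWm hW1, mul_div_assoc]
  congr 1
  rw [← integral_div]
  congr 1
  funext τ
  ring

/-- **`K_{n+1,l}(x)` in Schwinger form**:
`K_{n+1,l}(x) = (n!)⁻¹ ∫₀^∞ τⁿ (∫ |D̂|^l |D̂^{(x)}| e^{-(1-D̂)τ} dk/(2π)^d) dτ` for `d ≥ 2n + 3` —
the non-smooth weight case, out of reach of the walk-counting series.
[cite: FitznerVanDerHofstad2016NoBLE, (3.36) p. 1071; §5.1.1 (5.2)–(5.4)] -/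
theorem srwK_succ_eq_integral_Ioi (n : ℕ) (hd : 2 * (n + 1) + 1 ≤ d) (l : ℕ) (x : Fin d → ℤ) :
    srwK d (n + 1) l x
      = (n ! : ℝ)⁻¹ * ∫ τ in Ioi (0:ℝ), τ ^ n *
          ((∫ k, (|Dhat d k| ^ l * |DhatSym d x k|) * Real.exp (-((1 - Dhat d k) * τ)) ∂P d)
            / (2 * π) ^ d) := by
  have hWm : Measurable fun k => |Dhat d k| ^ l * |DhatSym d x k| :=
    (((continuous_Dhat d).measurable.abs).pow_const l).mul (measurable_DhatSym d x).abs
  have hW1 : ∀ k, |(|Dhat d k| ^ l * |DhatSym d x k|)| ≤ 1 := fun k => by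
    rw [abs_mul, abs_pow, abs_abs, abs_abs]
    exact mul_le_one₀ (abs_Dhat_pow_le_one l k) (abs_nonneg _) (abs_DhatSym_le_one x k)
  unfold srwK
  rw [integral_mul_Chat_pow_succ_eq_integral_Ioi_of_bdd n hd hWm hW1, mul_div_assoc]
  congr 1
  rw [← integral_div]
  congr 1
  funext τ
  ring

end Schwinger

/-! ## Part II — axis atoms factorise into one-coordinate transforms -/

section AxisTransform

variable {d : ℕ}

/-- `m e_i = m · e_i`. [folklore] -/
private theorem single_intCast_eq (i : Fin d) (m : ℤ) :
    (Pi.single i m : Fin d → ℤ) = fun j => m * (Pi.single i (1 : ℤ) : Fin d → ℤ) j := by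
  funext j
  by_cases h : j = i
  · subst h; simp
  · simp [Pi.single_eq_of_ne h]

/-- `D̂^{(m e_i)}(k) = D̂(m k) = d⁻¹ Σ_j cos (m k_j)`.
[cite: FitznerVanDerHofstad2016NoBLE, (3.34)–(3.36) p. 1071] -/
theorem DhatSym_single_intCast (i : Fin d) (m : ℤ) (k : Fin d → ℝ) :
    DhatSym d (Pi.single i m) k = Dhat d (fun j => (m : ℝ) * k j) := by
  rw [single_intCast_eq i m, DhatSym_smul m (Pi.single i 1) k, DhatSym_single]

/-- `d · D̂^{(m e_i)}(k) = Σ_j cos (m k_j)` — the symmetrised phase of an axis atom is a SUM over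
coordinates. [cite: FitznerVanDerHofstad2016NoBLE, (3.34)–(3.36) p. 1071] -/
theorem natCast_mul_DhatSym_single_intCast (i : Fin d) (m : ℤ) (k : Fin d → ℝ) :
    (d : ℝ) * DhatSym d (Pi.single i m) k = ∑ j, Real.cos ((m : ℝ) * k j) := by
  rw [DhatSym_single_intCast, Dhat_def]
  have hd : (d : ℝ) ≠ 0 := by
    have : 0 < d := Fin.pos i
    positivity
  field_simp

/-- `τ D̂(k) = Σ_j (τ/d) cos k_j` (also for `d = 0`). [folklore] -/
private theorem mul_Dhat_eq_sum (τ : ℝ) (k : Fin d → ℝ) : τ * Dhat d k = ∑ j, τ / d * Real.cos (k j) := by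
  rw [Dhat_def, div_eq_mul_inv, mul_comm (∑ j, Real.cos (k j)) _, ← mul_assoc, Finset.mul_sum]
  refine Finset.sum_congr rfl fun j _ => ?_
  ring

/-- `∫_{[-π,π]^d} e^{τ D̂(k)} dk = (∫_{-π}^{π} e^{(τ/d) cos t} dt)^d` (`= (2π I₀(τ/d))^d`).
[cite: DLMF, 10.32.1] -/
theorem integral_exp_mul_Dhat_P (τ : ℝ) :
    ∫ k, Real.exp (τ * Dhat d k) ∂P d = (∫ t, Real.exp (τ / d * Real.cos t) ∂μI) ^ d := by
  have h : ∀ k : Fin d → ℝ, Real.exp (τ * Dhat d k) = ∏ j, Real.exp (τ / d * Real.cos (k j)) := by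
    intro k; rw [mul_Dhat_eq_sum, Real.exp_sum]
  simp_rw [h]
  rw [show P d = Measure.pi (fun _ : Fin d => μI) from rfl,
    integral_fintype_prod_eq_prod (𝕜 := ℝ) (fun (_ : Fin d) (t : ℝ) => Real.exp (τ / d * Real.cos t))]
  rw [Finset.prod_const, Finset.card_univ, Fintype.card_fin]

/-- `∫ e^{τD̂(k)} e^{iβ Σ_j cos(m k_j)} dk = B_m(τ/d, β)^d` (Fubini on the product cube).
[cite: FitznerVanDerHofstad2016NoBLE, §5.1.1 (5.2)–(5.4)] -/
theorem integral_cexp_mul_Dhat_add_P (τ β : ℝ) (m : ℤ) :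
    ∫ k, Complex.exp (((τ * Dhat d k : ℝ) : ℂ) + ((β * ∑ j, Real.cos (m * k j) : ℝ) : ℂ) * Complex.I) ∂P d
      = (∫ t, Complex.exp (((τ / d * Real.cos t : ℝ) : ℂ) + ((β * Real.cos (m * t) : ℝ) : ℂ) * Complex.I) ∂μI) ^ d := by
  have h : ∀ k : Fin d → ℝ,
      Complex.exp (((τ * Dhat d k : ℝ) : ℂ) + ((β * ∑ j, Real.cos (m * k j) : ℝ) : ℂ) * Complex.I)
        = ∏ j, Complex.exp (((τ / d * Real.cos (k j) : ℝ) : ℂ)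
            + ((β * Real.cos (m * k j) : ℝ) : ℂ) * Complex.I) := by
    intro k
    rw [← Complex.exp_sum, mul_Dhat_eq_sum, Finset.mul_sum]
    push_cast
    rw [Finset.sum_mul, ← Finset.sum_add_distrib]
  simp_rw [h]
  rw [show P d = Measure.pi (fun _ : Fin d => μI) from rfl,
    integral_fintype_prod_eq_prod (𝕜 := ℂ) (fun (_ : Fin d) (t : ℝ) =>
      Complex.exp (((τ / d * Real.cos t : ℝ) : ℂ) + ((β * Real.cos (m * t) : ℝ) : ℂ) * Complex.I))]
  rw [Finset.prod_const, Finset.card_univ, Fintype.card_fin]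

/-- Bounded continuous functions are integrable against a finite measure. [folklore] -/
private lemma integrable_of_continuous_of_bound {α : Type*} [MeasurableSpace α]
    [TopologicalSpace α] [OpensMeasurableSpace α] (μ : Measure α) [IsFiniteMeasure μ]
    {E : Type*} [NormedAddCommGroup E] [SecondCountableTopologyEither α E] {f : α → E}
    (hf : Continuous f) (C : ℝ)
    (hC : ∀ x, ‖f x‖ ≤ C) : Integrable f μ :=
  (integrable_const C).mono' hf.aestronglyMeasurable (ae_of_all _ hC)

/-- Real part: `∫ e^{τD̂(k)} cos(β Σ_j cos(m k_j)) dk = Re B_m(τ/d, β)^d`.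
[cite: FitznerVanDerHofstad2016NoBLE, §5.1.1 (5.2)–(5.4)] -/
theorem integral_exp_mul_Dhat_mul_cos_P (τ β : ℝ) (m : ℤ) :
    ∫ k, Real.exp (τ * Dhat d k) * Real.cos (β * ∑ j, Real.cos (m * k j)) ∂P d
      = ((∫ t, Complex.exp (((τ / d * Real.cos t : ℝ) : ℂ) + ((β * Real.cos (m * t) : ℝ) : ℂ) * Complex.I) ∂μI) ^ d).re := by
  have hint : Integrable (fun k : Fin d → ℝ =>
      Complex.exp (((τ * Dhat d k : ℝ) : ℂ) + ((β * ∑ j, Real.cos (m * k j) : ℝ) : ℂ) * Complex.I)) (P d) := by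
    refine integrable_of_continuous_of_bound (P d) ?_ (Real.exp |τ|) fun k => ?_
    · have := continuous_Dhat d
      fun_prop
    · rw [Complex.norm_exp, Complex.add_re, Complex.ofReal_re, Complex.re_ofReal_mul,
        Complex.I_re, mul_zero, add_zero]
      exact Real.exp_le_exp.2 ((le_abs_self _).trans (by
        rw [abs_mul]; exact mul_le_of_le_one_right (abs_nonneg _) (abs_Dhat_le_one k)))
  have h2 : (fun k : Fin d → ℝ => Real.exp (τ * Dhat d k) * Real.cos (β * ∑ j, Real.cos (m * k j)))
      = fun k => RCLike.re (Complex.exp (((τ * Dhat d k : ℝ) : ℂ)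
          + ((β * ∑ j, Real.cos (m * k j) : ℝ) : ℂ) * Complex.I)) := by
    funext k
    rw [RCLike.re_to_complex, Complex.exp_re, Complex.add_re, Complex.ofReal_re,
      Complex.re_ofReal_mul, Complex.I_re, mul_zero, add_zero, Complex.add_im, Complex.ofReal_im,
      Complex.im_ofReal_mul, Complex.I_im, mul_one, zero_add]
  rw [h2, integral_re hint, integral_cexp_mul_Dhat_add_P, RCLike.re_to_complex]

/-- Bounded continuous functions are integrable against a finite measure. [folklore] -/
private lemma integrable_of_continuous_of_bound₂ {α : Type*} [MeasurableSpace α]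
    [TopologicalSpace α] [OpensMeasurableSpace α] (μ : Measure α) [IsFiniteMeasure μ]
    {E : Type*} [NormedAddCommGroup E] [SecondCountableTopologyEither α E] {f : α → E}
    (hf : Continuous f) (C : ℝ)
    (hC : ∀ x, ‖f x‖ ≤ C) : Integrable f μ :=
  (integrable_const C).mono' hf.aestronglyMeasurable (ae_of_all _ hC)

/-- `|e^{τ D̂(k)}| ≤ e^{|τ|}`. [folklore] -/
private theorem norm_exp_mul_Dhat_le (τ : ℝ) (k : Fin d → ℝ) : ‖Real.exp (τ * Dhat d k)‖ ≤ Real.exp |τ| := by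
  rw [Real.norm_eq_abs, Real.abs_exp]
  exact Real.exp_le_exp.2 ((le_abs_self _).trans (by
    rw [abs_mul]; exact mul_le_of_le_one_right (abs_nonneg _) (abs_Dhat_le_one k)))

/-- **The inner cube integral after the cosine-defect and Schwinger steps factorises over coordinates**:
`∫ (1 - cos(β d D̂^{(m e_i)}(k))) e^{-(1 - D̂(k))τ} dk = e^{-τ} ((∫_{-π}^{π} e^{(τ/d)cos t}dt)^d - Re B_m(τ/d, β)^d)`.
[cite: FitznerVanDerHofstad2016NoBLE, §5.1.1 (5.2)–(5.4)] -/
theorem integral_one_sub_cos_mul_exp_schwinger_single (τ β : ℝ) (i : Fin d) (m : ℤ) :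
    ∫ k, (1 - Real.cos (β * d * DhatSym d (Pi.single i m) k)) * Real.exp (-((1 - Dhat d k) * τ)) ∂P d
      = Real.exp (-τ) * ((∫ t, Real.exp (τ / d * Real.cos t) ∂μI) ^ d
          - ((∫ t, Complex.exp (((τ / d * Real.cos t : ℝ) : ℂ) + ((β * Real.cos (m * t) : ℝ) : ℂ) * Complex.I) ∂μI) ^ d).re) := by
  have hph : ∀ k : Fin d → ℝ, β * d * DhatSym d (Pi.single i m) k = β * ∑ j, Real.cos (m * k j) := by
    intro k; rw [mul_assoc, natCast_mul_DhatSym_single_intCast]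
  have hexp : ∀ k : Fin d → ℝ, Real.exp (-((1 - Dhat d k) * τ)) = Real.exp (-τ) * Real.exp (τ * Dhat d k) := by
    intro k; rw [← Real.exp_add]; congr 1; ring
  simp_rw [hph, hexp]
  have hD := continuous_Dhat d
  have i1 : Integrable (fun k : Fin d → ℝ => Real.exp (τ * Dhat d k)) (P d) :=
    integrable_of_continuous_of_bound₂ (P d) (by fun_prop) _ (norm_exp_mul_Dhat_le τ)
  have i2 : Integrable (fun k : Fin d → ℝ =>
      Real.exp (τ * Dhat d k) * Real.cos (β * ∑ j, Real.cos (m * k j))) (P d) := by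
    exact i1.mul_bdd (c := 1) (Continuous.aestronglyMeasurable (by fun_prop))
      (ae_of_all _ fun k => by rw [Real.norm_eq_abs]; exact Real.abs_cos_le_one _)
  have e : ∀ k : Fin d → ℝ, (1 - Real.cos (β * ∑ j, Real.cos (m * k j))) * (Real.exp (-τ) * Real.exp (τ * Dhat d k))
      = Real.exp (-τ) * (Real.exp (τ * Dhat d k) - Real.exp (τ * Dhat d k) * Real.cos (β * ∑ j, Real.cos (m * k j))) := by
    intro k; ring
  simp_rw [e]
  rw [integral_const_mul, integral_sub i1 i2, integral_exp_mul_Dhat_P, integral_exp_mul_Dhat_mul_cos_P]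

/-- **The cosine-defect / Schwinger reduction of an axis atom, per `β`**: for `d ≥ 2n + 3`,
`∫ (1 - cos(β d D̂^{(m e_i)}(k))) Ĉ(k)^{n+1} dk
   = (n!)⁻¹ ∫₀^∞ τⁿ e^{-τ} [(∫_{-π}^{π} e^{(τ/d) cos t} dt)^d − Re B_m(τ/d, β)^d] dτ`.
This is the inner integrand of `srwK_eq_integral_cosDefect_scaled` (module `SrwAbsCosineDefect`,
`l = 0`, `x = m e_i`), whence
`K_{n+1,0}(m e_i) = (2/(πd)) ∫₀^∞ β⁻² (this) / (2π)^d dβ`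
(`srwK_succ_zero_single_eq_integral_axisTransform`, a five-line composition of the two modules).
[cite: FitznerVanDerHofstad2016NoBLE, §5.1.1 (5.2)–(5.4)] -/
theorem integral_one_sub_cos_mul_Chat_pow_succ_single_eq (n : ℕ) (hd : 2 * (n + 1) + 1 ≤ d)
    (β : ℝ) (i : Fin d) (m : ℤ) :
    ∫ k, (1 - Real.cos (β * d * DhatSym d (Pi.single i m) k)) * Chat d 1 k ^ (n + 1) ∂P d
      = (n ! : ℝ)⁻¹ * ∫ τ in Ioi (0:ℝ), τ ^ n * (Real.exp (-τ) *
          ((∫ t, Real.exp (τ / d * Real.cos t) ∂μI) ^ d - ((∫ t, Complex.exp (((τ / d * Real.cos t : ℝ) : ℂ) + ((β * Real.cos (m * t) : ℝ) : ℂ) * Complex.I) ∂μI) ^ d).re)) := by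
  have hWm : AEStronglyMeasurable
      (fun k : Fin d → ℝ => 1 - Real.cos (β * d * DhatSym d (Pi.single i m) k)) (P d) :=
    Continuous.aestronglyMeasurable (by have := continuous_DhatSym d (Pi.single i m); fun_prop)
  have hW : Integrable
      (fun k : Fin d → ℝ => (1 - Real.cos (β * d * DhatSym d (Pi.single i m) k)) * Chat d 1 k ^ (n + 1))
      (P d) :=
    (integrable_Chat_pow (n + 1) hd zero_le_one le_rfl).bdd_mul hWm
      (ae_of_all _ fun k => by
        rw [Real.norm_eq_abs]
        have h1 := Real.abs_cos_le_one (β * d * DhatSym d (Pi.single i m) k)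
        have : |1 - Real.cos (β * d * DhatSym d (Pi.single i m) k)| ≤ 2 := by
          rw [abs_le] at h1 ⊢; constructor <;> linarith [h1.1, h1.2]
        exact this)
  have key : ∫ τ in Ioi (0:ℝ), τ ^ n * ∫ k, (1 - Real.cos (β * d * DhatSym d (Pi.single i m) k))
        * Real.exp (-((1 - Dhat d k) * τ)) ∂P d
      = ∫ τ in Ioi (0:ℝ), τ ^ n * (Real.exp (-τ) *
          ((∫ t, Real.exp (τ / d * Real.cos t) ∂μI) ^ d - ((∫ t, Complex.exp (((τ / d * Real.cos t : ℝ) : ℂ) + ((β * Real.cos (m * t) : ℝ) : ℂ) * Complex.I) ∂μI) ^ d).re)) :=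
    setIntegral_congr_fun measurableSet_Ioi fun τ _ => by
      rw [integral_one_sub_cos_mul_exp_schwinger_single]
  rw [integral_mul_Chat_pow_succ_eq_integral_Ioi n hWm hW, key]

end AxisTransform

end Literature.Probability.FitznerVanDerHofstad2017
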